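import Summits.KontsevichZagierPeriods.Zeta5Search.Certificates.RecordRayClassWindowsD16A
import Summits.KontsevichZagierPeriods.Zeta5Search.Certificates.RecordRayClassWindowsD16B
import Summits.KontsevichZagierPeriods.Zeta5Search.Certificates.RecordRayClassWindowsD16C
import HarnessLib

/-!
# ζ(5) search — the record ray's DENOMINATORS, XI-e (D16): the CLASS-LAW WINDOW LIST (p3 g6)

HONEST FRAMING: systematic search; no irrationality claim unless certified.

OUR work (Summit side; prover seat p3, generation 6).  `cwinsD16` = the concatenation of the 3 part lists (202 class-law windows) with
`cwinsD16_holds`.  Index `idx` of a kind-3/4 table row refers to this list.  Valuations of rationals; every `γ < 1` — no irrationality content.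
-/

noncomputable section

namespace Summit.KontsevichZagierPeriods.Zeta5Search.RecordRay

/-- All class-law windows of stage D16. -/
def cwinsD16 : List CWin := cwinsD16A ++ (cwinsD16B ++ cwinsD16C)

/-- **Every class-law window holds.** -/
theorem cwinsD16_holds : ∀ c ∈ cwinsD16, c.Holds := by
  unfold cwinsD16
  exact List.forall_mem_append.2 ⟨cwinsD16A_holds, List.forall_mem_append.2 ⟨cwinsD16B_holds, cwinsD16C_holds⟩⟩

end Summit.KontsevichZagierPeriods.Zeta5Search.RecordRay
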